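import Mathlib
import Literature.NumberTheory.EllipticCurves.TwoIsogenyDescentIndex
import Literature.NumberTheory.EllipticCurves.TwoIsogenySelmerGroupProofs

/-!
# Rank-2 observatory — KERNEL-ISO bookkeeping (C2): the rank lower bound from exhibited `α`-classes

HONEST FRAMING: per-curve certified theorems and census instruments; no claim on BSD in rank ≥ 2.

For `E_{a,b} : y² = x³ + a x² + b x` (`b (a² - 4b) ≠ 0`) the Literature proves Silverman–Tate's
`#α(Γ) · #ᾱ(Γ̄) = 2^{r+2}` (`WeierstrassCurve.natCard_range_xSqClass_mul`, `r = mordellWeilRank`,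
`α = xSqClass : (x, y) ↦ [x], T ↦ [b]`). To bound `r` from BELOW a per-curve file exhibits integers
`n₁, …, n_k` (resp. `n'₁, …`) whose square classes lie in `α(Γ)` (resp. `ᾱ(Γ̄)`) — the classes of rational
points, of `T`, and their products (`mul_mem_range_xSqClass`) — together with a kernel-decidable certificate
that they are pairwise distinct: for each pair, `nᵢ nⱼ` is a quadratic NON-residue modulo some small modulus
`q` taken from a per-curve list `Q` (so `nᵢ nⱼ` is not a rational square and `[nᵢ] ≠ [nⱼ]`).

* `nonResidue q N` / `not_isSquare_of_nonResidue` — the non-square certificate;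
* `pairwiseNonSquareVia Q L` / `length_le_natCard_range_xSqClass` — `k` certified-distinct classes in
  `α(Γ)` give `k ≤ #α(Γ)`;
* `le_mordellWeilRank_of_classes` — `k ≤ #α(Γ)`, `k' ≤ #ᾱ(Γ̄)`, `2^(s+1) < k k'` ⇒ `s ≤ r`;
* `sqClass_intCast_div_sq` — the class of `x = n / e²` is `[n]` (reading classes off rational points).

## References
* J. H. Silverman, J. Tate, *Rational Points on Elliptic Curves*, 2nd ed. (2015), §3.5 (the map `α`),
  §3.6 (`2^r = #α(Γ) #ᾱ(Γ̄) / 4`). [cite: SilvermanTate2015, §3.6]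
* J. E. Cremona, *Algorithms for Modular Elliptic Curves*, 2nd ed. (1997), §3.6, Method 1.
  [cite: CremonaAlgorithms1997, §3.6 (Method 1)]
-/

set_option linter.dupNamespace false

namespace Summit.BirchSwinnertonDyer.BirchSwinnertonDyer.Rank2Observatory.IsoLocal

open Literature.NumberTheory.EllipticCurves WeierstrassCurve
open WeierstrassCurve.Affine (sqClass sqClass_mul sqClass_sq sqClass_eq_one_iff SqUnits)

/-! ### A kernel-decidable non-square certificate -/

/-- `N` is a quadratic non-residue modulo `q ≠ 0`: no `t < q` has `t² ≡ N (mod q)`. [folklore] -/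
def nonResidue (q : ℕ) (N : ℤ) : Bool :=
  (q != 0) && (List.range q).all fun t : ℕ => !decide ((((t : ℤ) * t - N) % (q : ℤ)) = 0)

/-- A non-residue modulo some `q` is not the square of a rational number. [folklore] -/
theorem not_isSquare_of_nonResidue {q : ℕ} {N : ℤ} (h : nonResidue q N = true) :
    ¬ IsSquare ((N : ℤ) : ℚ) := by
  intro hsq
  rw [Rat.isSquare_intCast_iff] at hsq
  obtain ⟨r, hr⟩ := hsq
  simp only [nonResidue, Bool.and_eq_true, bne_iff_ne, ne_eq, List.all_eq_true, List.mem_range,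
    Bool.not_eq_true', decide_eq_false_iff_not] at h
  obtain ⟨hq0, hall⟩ := h
  have hqpos : (0 : ℤ) < q := by exact_mod_cast Nat.pos_of_ne_zero hq0
  have ht0 : ((r % q).toNat : ℤ) = r % q := Int.toNat_of_nonneg (Int.emod_nonneg _ hqpos.ne')
  have htq : (r % q).toNat < q := by
    have := Int.emod_lt_of_pos r hqpos
    omega
  apply hall _ htq
  rw [ht0, hr]
  have h1 : r % q ≡ r [ZMOD q] := Int.mod_modEq r q
  have h2 : r % q * (r % q) - r * r ≡ r * r - r * r [ZMOD q] := (h1.mul h1).sub_right _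
  rw [Int.ModEq] at h2
  rw [h2, sub_self, Int.zero_emod]

/-- Distinct square classes from a non-square product. [folklore] -/
theorem sqClass_ne_of_not_isSquare {m n : ℤ} (hm : m ≠ 0) (hn : n ≠ 0)
    (h : ¬ IsSquare ((m * n : ℤ) : ℚ)) : sqClass (m : ℚ) ≠ sqClass (n : ℚ) := by
  intro he
  apply h
  have hm' : (m : ℚ) ≠ 0 := by exact_mod_cast hm
  have hn' : (n : ℚ) ≠ 0 := by exact_mod_cast hn
  have h1 : sqClass ((m : ℚ) * n) = 1 := by
    rw [sqClass_mul hm' hn', he, SqUnits.mul_self]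
  obtain ⟨u, hu⟩ := (sqClass_eq_one_iff (mul_ne_zero hm' hn')).mp h1
  exact ⟨u, by push_cast; rw [hu, pow_two]⟩

/-- Every pair of entries of `L` has a non-residue witness in `Q`. [folklore] -/
def pairwiseNonSquareVia (Q : List ℕ) : List ℤ → Bool
  | [] => true
  | m :: l => (l.all fun n => Q.any fun q => nonResidue q (m * n)) && pairwiseNonSquareVia Q l

/-- Soundness of the pairwise certificate. [folklore] -/
theorem pairwise_of_cert (Q : List ℕ) : ∀ L : List ℤ, pairwiseNonSquareVia Q L = true →
    L.Pairwise (fun m n => ¬ IsSquare ((m * n : ℤ) : ℚ))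
  | [], _ => List.Pairwise.nil
  | m :: l, h => by
      simp only [pairwiseNonSquareVia, Bool.and_eq_true, List.all_eq_true, List.any_eq_true] at h
      refine List.Pairwise.cons (fun n hn => ?_) (pairwise_of_cert Q l h.2)
      obtain ⟨q, -, hq⟩ := h.1 n hn
      exact not_isSquare_of_nonResidue hq

/-! ### Counting classes in `α(Γ)` -/

/-- **`k` certified-distinct classes in `α(Γ)` give `k ≤ #α(Γ)`** (for `E_{a,b}` with `b (a² - 4b) ≠ 0`,
so that `α(Γ)` is finite). [cite: SilvermanTate2015, §3.6] -/
theorem length_le_natCard_range_xSqClass {a b : ℤ} (hab : b * (a ^ 2 - 4 * b) ≠ 0) (L : List ℤ)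
    (Q : List ℕ) (hL : (L.all fun n => n != 0) = true) (hpair : pairwiseNonSquareVia Q L = true)
    (hmem : ∀ n ∈ L, sqClass (n : ℚ) ∈ Set.range (⟨0, (a : ℚ), 0, (b : ℚ), 0⟩ : WeierstrassCurve ℚ).xSqClass) :
    L.length ≤ Nat.card (Set.range (⟨0, (a : ℚ), 0, (b : ℚ), 0⟩ : WeierstrassCurve ℚ).xSqClass) := by
  haveI := isElliptic_mk_of_ne_zero (F := ℚ) hab
  set W : WeierstrassCurve ℚ := ⟨0, (a : ℚ), 0, (b : ℚ), 0⟩ with hW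
  have hne : Nat.card (Set.range W.xSqClass) ≠ 0 := by
    intro h0
    have h := W.natCard_range_xSqClass_mul
    rw [h0, zero_mul] at h
    exact absurd h.symm (pow_ne_zero _ two_ne_zero)
  haveI : Finite (Set.range W.xSqClass) := Nat.finite_of_card_ne_zero hne
  have hL' : ∀ n ∈ L, n ≠ 0 := by
    simpa only [List.all_eq_true, bne_iff_ne, ne_eq] using hL
  have hpw := pairwise_of_cert Q L hpair
  let f : Fin L.length → Set.range W.xSqClass := fun i => ⟨sqClass (L.get i : ℚ), hmem _ (List.get_mem L i)⟩
  have hf : Function.Injective f := by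
    intro i j hij
    simp only [f, Subtype.mk.injEq] at hij
    by_contra hne'
    rcases lt_or_gt_of_ne (Fin.val_ne_of_ne hne') with hlt | hgt
    · have hp := List.pairwise_iff_get.mp hpw i j hlt
      exact sqClass_ne_of_not_isSquare (hL' _ (List.get_mem L i)) (hL' _ (List.get_mem L j)) hp hij
    · have hp := List.pairwise_iff_get.mp hpw j i hgt
      exact sqClass_ne_of_not_isSquare (hL' _ (List.get_mem L j)) (hL' _ (List.get_mem L i)) hp hij.symm
  simpa using Nat.card_le_card_of_injective f hf

/-- **The rank lower bound**: `k ≤ #α(Γ)`, `k' ≤ #ᾱ(Γ̄)` and `2^(s+1) < k k'` give `s ≤ rank E_{a,b}(ℚ)`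
(`#α(Γ) #ᾱ(Γ̄) = 2^{r+2}`). Here `Γ̄ = E₂(ℚ)` for `E₂ = twoIsogenyCodomain = ⟨0, -2a, 0, a² - 4b, 0⟩`.
[cite: SilvermanTate2015, §3.6] -/
theorem le_mordellWeilRank_of_classes {a b : ℤ} (hab : b * (a ^ 2 - 4 * b) ≠ 0) {k k' s : ℕ}
    (hk : k ≤ Nat.card (Set.range (⟨0, (a : ℚ), 0, (b : ℚ), 0⟩ : WeierstrassCurve ℚ).xSqClass))
    (hk' : k' ≤ Nat.card (Set.range
      (⟨0, (a : ℚ), 0, (b : ℚ), 0⟩ : WeierstrassCurve ℚ).twoIsogenyCodomain.xSqClass))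
    (hs : 2 ^ (s + 1) < k * k') :
    s ≤ (⟨0, (a : ℚ), 0, (b : ℚ), 0⟩ : WeierstrassCurve ℚ).mordellWeilRank := by
  haveI := isElliptic_mk_of_ne_zero (F := ℚ) hab
  have h := (⟨0, (a : ℚ), 0, (b : ℚ), 0⟩ : WeierstrassCurve ℚ).natCard_range_xSqClass_mul
  have h1 : 2 ^ (s + 1) < 2 ^ ((⟨0, (a : ℚ), 0, (b : ℚ), 0⟩ : WeierstrassCurve ℚ).mordellWeilRank + 2) := by
    rw [← h]
    exact lt_of_lt_of_le hs (Nat.mul_le_mul hk hk')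
  have h2 := (Nat.pow_lt_pow_iff_right (by norm_num : 1 < 2)).mp h1
  omega

/-- The class of `x = n / e²` (`n, e ≠ 0`) is `[n]`. [folklore] -/
theorem sqClass_div_sq {n e : ℚ} (hn : n ≠ 0) (he : e ≠ 0) : sqClass (n / e ^ 2) = sqClass n := by
  have : n / e ^ 2 = n * (e⁻¹ * e⁻¹) := by field_simp
  rw [this, sqClass_mul hn (mul_ne_zero (inv_ne_zero he) (inv_ne_zero he)),
    WeierstrassCurve.Affine.sqClass_mul_self, mul_one]

/-- `[x(P)] ∈ α(Γ)` for a point `P = (x, y)` with `x ≠ 0`. [cite: SilvermanTate2015, §3.5] -/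
theorem sqClass_mem_range_of_point {F : Type*} [Field F] (W : WeierstrassCurve F) {x y : F}
    (h : W.toAffine.Nonsingular x y) (hx : x ≠ 0) : sqClass x ∈ Set.range W.xSqClass :=
  ⟨.some x y h, xSqClass_some_of_ne_zero h hx⟩

/-- `[b] = α(T) ∈ α(Γ)`. [cite: SilvermanTate2015, §3.5] -/
theorem sqClass_a₄_mem_range {F : Type*} [Field F] (W : WeierstrassCurve F) [W.IsTwoTorsionNF]
    [W.IsElliptic] : sqClass W.a₄ ∈ Set.range W.xSqClass :=
  ⟨W.twoTorsionPoint, xSqClass_twoTorsionPoint W⟩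

/-- `1 = α(O) ∈ α(Γ)`. [cite: SilvermanTate2015, §3.5] -/
theorem one_mem_range {F : Type*} [Field F] (W : WeierstrassCurve F) : (1 : SqUnits F) ∈ Set.range W.xSqClass :=
  ⟨0, xSqClass_zero W⟩

/-- Products: `[m] , [n] ∈ α(Γ)` ⇒ `[m n] ∈ α(Γ)` (integers `m, n ≠ 0`). [cite: SilvermanTate2015, §3.5] -/
theorem sqClass_mul_mem_range {F : Type*} [Field F] (W : WeierstrassCurve F) [W.IsTwoTorsionNF]
    [W.IsElliptic] {m n : F} (hm : m ≠ 0) (hn : n ≠ 0) (h₁ : sqClass m ∈ Set.range W.xSqClass)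
    (h₂ : sqClass n ∈ Set.range W.xSqClass) : sqClass (m * n) ∈ Set.range W.xSqClass := by
  rw [sqClass_mul hm hn]
  exact mul_mem_range_xSqClass W h₁ h₂

/-! ### Sanity checks -/

/-- `3 · 5 = 15` is a non-residue mod `7`; `2, 3, 6`: all pairwise products non-squares. [folklore] -/
example : pairwiseNonSquareVia [7, 8, 5] [1, 2, 3, 6] = true := by decide

end Summit.BirchSwinnertonDyer.BirchSwinnertonDyer.Rank2Observatory.IsoLocal
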